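import Summits.QuantumFields.YangMills.Theorems.BalabanLadderUVSeamRecCeilingsDLRPeelingCollars
import HarnessLib

/-!
# Crux `UVSeamRec` (stmt-QuantumFields-20043), lane B: every UNGUARDED one-box supplier is a GUARDED one — (UCR_k) ⇒ (GUCR_k) with the same
# weights, so v8d's large-field clause is WEAKER than v8c's

Helper file (`--supports stmt-QuantumFields-20043`) of the width-lever seat `ym-20043-ceilings-p2` (lane B, gen 9); a by-name comparison for the
owner / LEAD between gen 8's v8c currency ((UCR): `kerE^η_{child collar cube}(1_{blockField_k(z) ≥ ε_k}) ≤ w_k` for every exterior) and gen 9's v8d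
currency ((GUCR): `kerE^η_{parent collar cube}(1_{blockField_k(z) ≥ e ∧ ¬ blockField_{k+s}(z/b^s) ≥ ρe}) ≤ w_k` for every exterior and every `e ≥ ε_k`).
* `childCollar_subset_parentCollar` — for guard depth `s ≥ 1` and collar `m ≥ 1` the collar cube of the level-`k` block (corner `b^k(z − m)`, side
  `(2m+1)b^k`) sits inside the collar cube of its b-adic `s`-parent (corner `b^{k+s}(z/b^s − m)`, side `(2m+1)b^{k+s}`).
* `guardedConditionalRarity_of_uniformConditionalRarity` — (UCR_k) at threshold `ε_k` ⇒ (GUCR_k) at every threshold `e ≥ ε_k`, same weight: the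
  guarded event is contained in the unguarded one, the unguarded one is antitone in the threshold, and an exterior-uniform kernel bound passes to the
  larger cube by DLR consistency (gen 7's `kerE_le_of_forall_kerE_le_of_subset`).
So every supplier of v8c's `stub_backgroundFieldUCR` large-field clause supplies v8d's `stub_backgroundFieldGUCR` clause verbatim (given `s ≥ 1`); the
guarded clause is the weaker ask, and it is the one conjecturally free of the flat-penetration floor.
HONEST FRAMING: monotonicity bookkeeping; no large-field input is asserted; nothing of E0′; not a gap, not Clay.  References: folklore;
[Georgii2011] Def. 1.23 (iii) (consistency of a specification).
-/

set_option autoImplicit false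

noncomputable section

open MeasureTheory
open Literature.MathematicalPhysics.QuantumFieldTheory (LatticeRep)
open Literature.MathematicalPhysics.QuantumLattice (LGConfig)

namespace Summit.QuantumFields.YangMills.Cruxes.UVSeamRec.DLRPeeling

open Summit.QuantumFields.YangMills.Cruxes.OSLegsFromFemtoAndGap.DlrCollarTransfer
open Summit.QuantumFields.YangMills.Cruxes.UVSeamRec.PolymerData
open Summit.QuantumFields.YangMills.Cruxes.NT.BoundaryLaw (cubeSites_subset cubeEdges_subset)

/-- **The child's collar cube sits in the parent's** (`s ≥ 1`, `m ≥ 1`): with `P = b^{k+s}·(z/b^s) ∈ (b^k z − b^{k+s}, b^k z]`,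
`P − m b^{k+s} ≤ b^k z − m b^k` and `b^k z + (m+1) b^k ≤ P + (m+1) b^{k+s}` (the latter since `m b^k(b^s − 1) + 1 ≥ b^k`). [folklore] -/
theorem childCollar_subset_parentCollar (𝔟 : BlockSize) (k : ℕ) {s m : ℕ} (hs : 1 ≤ s) (hm : 1 ≤ m) (z : Fin 4 → ℤ) :
    cubeSites (fun i => (𝔟.b : ℤ) ^ k * (z i - m)) ((2 * m + 1) * 𝔟.b ^ k) ⊆
      cubeSites (fun i => (𝔟.b : ℤ) ^ (k + s) * (z i / (𝔟.b : ℤ) ^ s - m)) ((2 * m + 1) * 𝔟.b ^ (k + s)) := by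
  refine cubeSites_subset fun j => ?_
  have hb3 : (3 : ℤ) ≤ (𝔟.b : ℤ) := by exact_mod_cast BlockFieldLocality.three_le_b 𝔟
  have hb : (0 : ℤ) < (𝔟.b : ℤ) := by linarith
  have hbs : (0 : ℤ) < (𝔟.b : ℤ) ^ s := pow_pos hb s
  have hbk : (0 : ℤ) < (𝔟.b : ℤ) ^ k := pow_pos hb k
  have hbs3 : (3 : ℤ) ≤ (𝔟.b : ℤ) ^ s := by
    calc (3 : ℤ) ≤ (𝔟.b : ℤ) ^ 1 := by rw [pow_one]; exact hb3
      _ ≤ (𝔟.b : ℤ) ^ s := pow_le_pow_right₀ (by linarith) hs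
  have hm1 : (1 : ℤ) ≤ m := by exact_mod_cast hm
  have h1 : (𝔟.b : ℤ) ^ s * (z j / (𝔟.b : ℤ) ^ s) ≤ z j := Int.mul_ediv_self_le hbs.ne'
  have h2 : z j < (𝔟.b : ℤ) ^ s * (z j / (𝔟.b : ℤ) ^ s) + (𝔟.b : ℤ) ^ s := Int.lt_mul_ediv_self_add hbs
  have hpow : (𝔟.b : ℤ) ^ (k + s) = (𝔟.b : ℤ) ^ k * (𝔟.b : ℤ) ^ s := pow_add _ _ _
  -- `P ∈ (A − b^{k+s}, A]` after multiplying by `b^k`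
  have hP1 : (𝔟.b : ℤ) ^ (k + s) * (z j / (𝔟.b : ℤ) ^ s) ≤ (𝔟.b : ℤ) ^ k * z j := by
    rw [hpow, mul_assoc]; exact mul_le_mul_of_nonneg_left h1 hbk.le
  have hP2 : (𝔟.b : ℤ) ^ k * z j + (𝔟.b : ℤ) ^ k ≤ (𝔟.b : ℤ) ^ (k + s) * (z j / (𝔟.b : ℤ) ^ s) + (𝔟.b : ℤ) ^ (k + s) := by
    have : (𝔟.b : ℤ) ^ k * (z j + 1) ≤ (𝔟.b : ℤ) ^ k * ((𝔟.b : ℤ) ^ s * (z j / (𝔟.b : ℤ) ^ s) + (𝔟.b : ℤ) ^ s) :=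
      mul_le_mul_of_nonneg_left (by linarith) hbk.le
    rw [hpow]; nlinarith
  have hks : (𝔟.b : ℤ) ^ k ≤ (𝔟.b : ℤ) ^ (k + s) := by rw [hpow]; nlinarith
  have hside : (((2 * m + 1) * 𝔟.b ^ (k + s) : ℕ) : ℤ) = (2 * m + 1) * (𝔟.b : ℤ) ^ (k + s) := by push_cast; ring
  have hside' : (((2 * m + 1) * 𝔟.b ^ k : ℕ) : ℤ) = (2 * m + 1) * (𝔟.b : ℤ) ^ k := by push_cast; ring
  rw [hside, hside']
  constructor
  · -- lower corner
    nlinarith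
  · -- upper corner: `A + (m+1)b^k ≤ P + (m+1)b^{k+s}`, using `m b^k (b^s − 1) ≥ b^k`
    have hgap : (𝔟.b : ℤ) ^ k ≤ (m : ℤ) * ((𝔟.b : ℤ) ^ (k + s) - (𝔟.b : ℤ) ^ k) := by
      rw [hpow]; nlinarith
    nlinarith

variable {N : ℕ} [NeZero N]

/-- **(UCR_k) ⇒ (GUCR_k) WITH THE SAME WEIGHT.**  `SU(N)`, any lattice representation, any `β`; block size `𝔟`, level `k`, block index `z`,
orientation `μ<ν`, collar `m ≥ 1`, guard depth `s ≥ 1`, ratio `ρ`, thresholds `ε_k ≤ e`.  If the UNGUARDED one-box bound holds at threshold `ε_k` —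
`kerE^ζ_{(b^k(z−m),(2m+1)b^k)}(1_{largeFieldEvent ε_k (k,z,μν)}) ≤ w` for EVERY exterior `ζ` — then the GUARDED bound holds at threshold `e` over the
PARENT's collar cube for every exterior `η`:
`kerE^η_{(b^{k+s}(z/b^s − m),(2m+1)b^{k+s})}(1_{largeFieldEvent e (k,z,μν) ∖ largeFieldEvent (ρe) (k+s, z/b^s, μν)}) ≤ w`
(guarded ⊆ unguarded, antitone in the threshold, kernel monotone, DLR consistency to the larger cube). [folklore] -/
theorem guardedConditionalRarity_of_uniformConditionalRarity (r : LatticeRep (Matrix.specialUnitaryGroup (Fin N) ℂ)) (β : ℝ) (𝔟 : BlockSize)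
    (k : ℕ) (z : Fin 4 → ℤ) (μ ν : Fin 4) (hμν : μ < ν) {m s : ℕ} (hm : 1 ≤ m) (hs : 1 ≤ s) (ρ : ℝ) {εk e w : ℝ} (he : εk ≤ e)
    (h : ∀ ζ : LGConfig 4 (Matrix.specialUnitaryGroup (Fin N) ℂ),
      kerE (Matrix.specialUnitaryGroup (Fin N) ℂ) r β (fun i => (𝔟.b : ℤ) ^ k * (z i - m)) ((2 * m + 1) * 𝔟.b ^ k) ζ
        ((largeFieldEvent (N := N) 𝔟 εk ⟨k, z, μ, ν, hμν⟩).indicator fun _ => (1 : ℝ)) ≤ w)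
    (η : LGConfig 4 (Matrix.specialUnitaryGroup (Fin N) ℂ)) :
    kerE (Matrix.specialUnitaryGroup (Fin N) ℂ) r β (fun c => (𝔟.b : ℤ) ^ (k + s) * (z c / (𝔟.b : ℤ) ^ s - m)) ((2 * m + 1) * 𝔟.b ^ (k + s)) η
      ((largeFieldEvent (N := N) 𝔟 e ⟨k, z, μ, ν, hμν⟩ \
        largeFieldEvent (N := N) 𝔟 (ρ * e) ⟨k + s, fun c => z c / (𝔟.b : ℤ) ^ s, μ, ν, hμν⟩).indicator fun _ => (1 : ℝ)) ≤ w := by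
  classical
  haveI := r.secondCountableTopology
  -- the unguarded bound over the PARENT's cube, by DLR consistency
  have hbig : ∀ η' : LGConfig 4 (Matrix.specialUnitaryGroup (Fin N) ℂ),
      kerE (Matrix.specialUnitaryGroup (Fin N) ℂ) r β (fun c => (𝔟.b : ℤ) ^ (k + s) * (z c / (𝔟.b : ℤ) ^ s - m))
        ((2 * m + 1) * 𝔟.b ^ (k + s)) η' ((largeFieldEvent (N := N) 𝔟 εk ⟨k, z, μ, ν, hμν⟩).indicator fun _ => (1 : ℝ)) ≤ w := by
    refine kerE_le_of_forall_kerE_le_of_subset (Matrix.specialUnitaryGroup (Fin N) ℂ) r β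
      (cubeEdges_subset (childCollar_subset_parentCollar 𝔟 k hs hm z))
      (measurable_const.indicator (measurableSet_largeFieldEvent (N := N) 𝔟 εk _))
      (fun U => Set.indicator_nonneg (fun _ _ => zero_le_one) _) (M := 1) (fun U => ?_) h
    rw [abs_of_nonneg (Set.indicator_nonneg (fun _ _ => zero_le_one) _)]
    exact Set.indicator_apply_le' (fun _ => le_rfl) (fun _ => zero_le_one)
  -- guarded ⊆ unguarded at threshold `e` ⊆ unguarded at threshold `εk`
  have hsub : largeFieldEvent (N := N) 𝔟 e ⟨k, z, μ, ν, hμν⟩ \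
      largeFieldEvent (N := N) 𝔟 (ρ * e) ⟨k + s, fun c => z c / (𝔟.b : ℤ) ^ s, μ, ν, hμν⟩ ⊆
      largeFieldEvent (N := N) 𝔟 εk ⟨k, z, μ, ν, hμν⟩ := fun U hU => he.trans hU.1
  have hpt : ∀ U : LGConfig 4 (Matrix.specialUnitaryGroup (Fin N) ℂ),
      (largeFieldEvent (N := N) 𝔟 e ⟨k, z, μ, ν, hμν⟩ \
        largeFieldEvent (N := N) 𝔟 (ρ * e) ⟨k + s, fun c => z c / (𝔟.b : ℤ) ^ s, μ, ν, hμν⟩).indicator (fun _ => (1 : ℝ)) U ≤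
      (largeFieldEvent (N := N) 𝔟 εk ⟨k, z, μ, ν, hμν⟩).indicator (fun _ => (1 : ℝ)) U := fun U =>
    Set.indicator_le_indicator_of_subset hsub (fun _ => zero_le_one) U
  haveI := Literature.MathematicalPhysics.QuantumLattice.isProbabilityMeasure_ymSpecification r.ρ r.continuous β
    (cubeEdges (fun c => (𝔟.b : ℤ) ^ (k + s) * (z c / (𝔟.b : ℤ) ^ s - m)) ((2 * m + 1) * 𝔟.b ^ (k + s))) η
  refine le_trans ?_ (hbig η)
  unfold kerE
  refine integral_mono_of_nonneg (ae_of_all _ fun U => Set.indicator_nonneg (fun _ _ => zero_le_one) _) ?_ (ae_of_all _ hpt)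
  exact Literature.MathematicalPhysics.QuantumLattice.integrable_of_abs_le
    (measurable_const.indicator (measurableSet_largeFieldEvent (N := N) 𝔟 εk _)) (C := 1) fun U => by
    rw [abs_of_nonneg (Set.indicator_nonneg (fun _ _ => zero_le_one) _)]
    exact Set.indicator_apply_le' (fun _ => le_rfl) (fun _ => zero_le_one)

end Summit.QuantumFields.YangMills.Cruxes.UVSeamRec.DLRPeeling

end
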